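import Mathlib
import Summits.Parity.GeneralizedHardyLittlewood.Theorems.FordMaynardSieveConst01651SieveConst01651ShellSeparation

/-!
# Route `FordMaynardSieveConst01651`, target `SieveConst01651` (stmt-Parity-19185), line `sieve_decomposition`:
# helpers towards `stub_typeIIRegion` — Ford–Maynard Lemma 7.11 ("encoding many polytope conditions") as a
# `BilinBoundedBy` transformer, and the lattice-point count of a shell

Continuation of `…ShellSeparation` (Lemma 7.10 for bilinear forms: `bilin_threshold_shell` — threshold separation
WITHOUT a gap hypothesis, at the cost `3(1 + log R)` plus the mass of the kernel on the shell `|A z - B w| < 1/R`).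

* `bilin_thresholds_shell` — Lemma 7.11: `r` threshold conditions `[Bᵢ w < Aᵢ z]` (`|Aᵢ z - Bᵢ w| ≤ R`) cost
  `(3(1 + log R))^r` and one shell each:
  `BilinBoundedBy ((∏ᵢ [Bᵢ w < Aᵢ z]) · K) W Z ((3(1 + log R))^r · (X + Σᵢ Σ_{|Aᵢ z - Bᵢ w| < 1/R} ‖K w z‖))`.
* `card_filter_abs_mul_log_sub_le_one` — the count behind Ford–Maynard's `S₄`: if `2δx < |c|` then at most one
  integer `1 ≤ s ≤ x` has `|c log s - t| ≤ δ` (in the paper `δ ≍ x⁻²`, `|c| ≥ 1`: "the product `n₁⋯n_j` is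
  unique", so a shell holds `≤ τ_j`-many tuples per cofactor).

Def-free. Nothing here proves anything about the Parity summit; helpers for the Type-II region stub of one leaf.
-/

noncomputable section

open Real Complex MeasureTheory Set Finset
open scoped FourierTransform
open Literature.NumberTheory.Sieve.FriedlanderIwaniecPrimes

namespace Summit.Parity.GeneralizedHardyLittlewood.FordMaynardSieveConst01651SieveConst01651

variable {ι κ : Type*}

/-! ### Many conditions (Ford–Maynard Lemma 7.11) and the lattice-point count of a shell -/

/-- A product of threshold indicators has norm at most `1`. [folklore] -/
theorem norm_prod_indicator_le_one (l : List ((κ → ℝ) × (ι → ℝ))) (w : ι) (z : κ) :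
    ‖(l.map fun p => if p.2 w < p.1 z then (1 : ℂ) else 0).prod‖ ≤ 1 := by
  induction l with
  | nil => simp
  | cons p l ih =>
    simp only [List.map_cons, List.prod_cons, norm_mul]
    exact mul_le_one₀ (by split_ifs <;> simp) (norm_nonneg _) ih

/-- **Ford–Maynard Lemma 7.11 for bilinear forms (encoding many conditions).** Iterating
`bilin_threshold_shell` over a list of `r` threshold conditions `[Bᵢ w < Aᵢ z]` with `|Aᵢ z - Bᵢ w| ≤ R` on
`W × Z`: every bilinear form in `(∏ᵢ [Bᵢ w < Aᵢ z]) · K` with `1`-bounded coefficients is at most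
`(3(1 + log R))^r · (X + ∑ᵢ ∑_{|Aᵢ z - Bᵢ w| < 1/R} ‖K w z‖)` — one factor `3(1 + log R)` per condition
(the printed `(log x)^{|𝒯|}`) and one shell per condition. [cite: FordMaynard2024PrimeSieves, Lemma 7.11] -/
theorem bilin_thresholds_shell {K : ι → κ → ℂ} {W : Finset ι} {Z : Finset κ} {X : ℝ}
    (h : BilinBoundedBy K W Z X) {R : ℝ} (hR : 1 ≤ R) :
    ∀ l : List ((κ → ℝ) × (ι → ℝ)), (∀ p ∈ l, ∀ w ∈ W, ∀ z ∈ Z, |p.1 z - p.2 w| ≤ R) →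
      BilinBoundedBy (fun w z => (l.map fun p => if p.2 w < p.1 z then (1 : ℂ) else 0).prod * K w z) W Z
        ((3 * (1 + Real.log R)) ^ l.length *
          (X + (l.map fun p => ∑ w ∈ W, ∑ z ∈ Z,
            if |p.1 z - p.2 w| < 1 / R then ‖K w z‖ else 0).sum)) := by
  have hX0 : 0 ≤ X := h.nonneg
  have hc1 : 1 ≤ 3 * (1 + Real.log R) := by
    have := Real.log_nonneg hR; linarith
  intro l
  induction l with
  | nil =>
    intro _
    refine (h.mono (le_of_eq ?_)).congr fun w _ z _ => ?_
    · simp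
    · simp
  | cons p l ih =>
    intro hl
    have ih' := ih fun q hq => hl q (List.mem_cons_of_mem p hq)
    have hp := hl p (List.mem_cons_self)
    -- the shell sums are nonnegative
    have hS0 : ∀ q : (κ → ℝ) × (ι → ℝ),
        0 ≤ ∑ w ∈ W, ∑ z ∈ Z, (if |q.1 z - q.2 w| < 1 / R then ‖K w z‖ else 0 : ℝ) := fun q =>
      sum_nonneg fun w _ => sum_nonneg fun z _ => by split_ifs <;> simp
    have hL0 : 0 ≤ (l.map fun q => ∑ w ∈ W, ∑ z ∈ Z,
        (if |q.1 z - q.2 w| < 1 / R then ‖K w z‖ else 0 : ℝ)).sum :=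
      List.sum_nonneg (by
        intro a ha
        obtain ⟨q, _, rfl⟩ := List.mem_map.mp ha
        exact hS0 q)
    -- one more condition
    have h1 := bilin_threshold_shell ih' (A := p.1) (B := p.2) hR hp
    -- the new shell only sees `‖K‖`
    have hshell : ∑ w ∈ W, ∑ z ∈ Z, (if |p.1 z - p.2 w| < 1 / R then
        ‖(l.map fun q => if q.2 w < q.1 z then (1 : ℂ) else 0).prod * K w z‖ else 0 : ℝ) ≤
        ∑ w ∈ W, ∑ z ∈ Z, (if |p.1 z - p.2 w| < 1 / R then ‖K w z‖ else 0 : ℝ) := by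
      refine sum_le_sum fun w _ => sum_le_sum fun z _ => ?_
      split_ifs
      · rw [norm_mul]
        calc _ ≤ 1 * ‖K w z‖ := mul_le_mul_of_nonneg_right (norm_prod_indicator_le_one l w z) (norm_nonneg _)
          _ = ‖K w z‖ := one_mul _
      · exact le_rfl
    refine (h1.mono ?_).congr fun w _ z _ => ?_
    · -- bookkeeping of the constant
      simp only [List.map_cons, List.sum_cons, List.length_cons, pow_succ]
      set c : ℝ := 3 * (1 + Real.log R) with hc
      set n : ℕ := l.length
      set Sl : ℝ := (l.map fun q => ∑ w ∈ W, ∑ z ∈ Z,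
        (if |q.1 z - q.2 w| < 1 / R then ‖K w z‖ else 0 : ℝ)).sum
      set Sp : ℝ := ∑ w ∈ W, ∑ z ∈ Z, (if |p.1 z - p.2 w| < 1 / R then ‖K w z‖ else 0 : ℝ)
      have hcn1 : 1 ≤ c ^ n * c := by
        calc (1 : ℝ) = 1 * 1 := by ring
          _ ≤ c ^ n * c := mul_le_mul (one_le_pow₀ hc1) hc1 zero_le_one (by positivity)
      have hSp0 : 0 ≤ Sp := hS0 p
      calc c * (c ^ n * (X + Sl)) + ∑ w ∈ W, ∑ z ∈ Z, (if |p.1 z - p.2 w| < 1 / R then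
              ‖(l.map fun q => if q.2 w < q.1 z then (1 : ℂ) else 0).prod * K w z‖ else 0 : ℝ)
          ≤ c * (c ^ n * (X + Sl)) + Sp := by linarith [hshell]
        _ ≤ c * (c ^ n * (X + Sl)) + c ^ n * c * Sp := by nlinarith
        _ = c ^ n * c * (X + (Sp + Sl)) := by ring
    · simp only [List.map_cons, List.prod_cons]
      ring

/-- **The lattice-point count behind Ford–Maynard's `S₄`.** For `|c| ≥ 2δx` strictly, at most ONE integer
`1 ≤ s ≤ x` has `|c log s - t| ≤ δ`: two such integers `s < s'` would give
`|c| / x ≤ |c| (log s' - log s) ≤ 2δ`. (In the paper: `δ = O(x⁻²)`, `|c| ≥ 1`, "the product `n₁⋯n_j` is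
unique".) [cite: FordMaynard2024PrimeSieves, Lemma 7.10 (proof, `S₄`)] -/
theorem card_filter_abs_mul_log_sub_le_one {c t δ x : ℝ} (hδ : 2 * δ * x < |c|) :
    ((Finset.Icc 1 ⌊x⌋₊).filter (fun s : ℕ => |c * Real.log s - t| ≤ δ)).card ≤ 1 := by
  -- two distinct solutions are impossible
  have key : ∀ a ∈ (Finset.Icc 1 ⌊x⌋₊).filter (fun s : ℕ => |c * Real.log s - t| ≤ δ),
      ∀ b ∈ (Finset.Icc 1 ⌊x⌋₊).filter (fun s : ℕ => |c * Real.log s - t| ≤ δ), a < b → False := by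
    intro a ha b hb hab
    rw [mem_filter, Finset.mem_Icc] at ha hb
    obtain ⟨⟨ha1, _⟩, hat⟩ := ha
    obtain ⟨⟨_, hbx⟩, hbt⟩ := hb
    have ha0 : (0 : ℝ) < a := by exact_mod_cast ha1
    have hb0 : (0 : ℝ) < b := by exact_mod_cast (lt_of_lt_of_le ha1 hab.le)
    have hx0 : 0 < x := by
      by_contra hx
      rw [Nat.floor_of_nonpos (le_of_not_gt hx)] at hbx
      omega
    have hbx' : (b : ℝ) ≤ x := le_trans (by exact_mod_cast hbx) (Nat.floor_le hx0.le)
    have hab1 : (a : ℝ) + 1 ≤ b := by exact_mod_cast hab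
    -- `log b - log a ≥ (b - a)/b ≥ 1/x`
    have hlog : 1 / x ≤ Real.log b - Real.log a := by
      have h1 : Real.log ((a : ℝ) / b) ≤ (a : ℝ) / b - 1 := Real.log_le_sub_one_of_pos (by positivity)
      rw [Real.log_div ha0.ne' hb0.ne'] at h1
      have h2 : 1 / x ≤ 1 - (a : ℝ) / b := by
        rw [div_le_iff₀ hx0, sub_mul, div_mul_eq_mul_div, le_sub_iff_add_le]
        have : (a : ℝ) * x / b ≤ x - x / b := by
          rw [div_le_iff₀ hb0, sub_mul, div_mul_cancel₀ _ hb0.ne']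
          nlinarith
        have hxb : x / b ≥ 1 := by rw [ge_iff_le, le_div_iff₀ hb0]; linarith
        linarith
      linarith
    -- `|c| (log b - log a) ≤ 2δ`
    have hdiff : |c| * (Real.log b - Real.log a) ≤ 2 * δ := by
      have : |c * Real.log b - t - (c * Real.log a - t)| ≤ δ + δ :=
        (abs_sub _ _).trans (add_le_add hbt hat)
      rw [show c * Real.log b - t - (c * Real.log a - t) = c * (Real.log b - Real.log a) by ring,
        abs_mul, abs_of_nonneg (by linarith [one_div_pos.mpr hx0] : 0 ≤ Real.log b - Real.log a)] at this
      linarith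
    have hc0 : 0 ≤ |c| := abs_nonneg c
    have : |c| * (1 / x) ≤ 2 * δ := (mul_le_mul_of_nonneg_left hlog hc0).trans hdiff
    rw [mul_one_div, div_le_iff₀ hx0] at this
    linarith
  refine Finset.card_le_one.mpr fun a ha b hb => ?_
  rcases lt_trichotomy a b with hab | hab | hab
  · exact (key a ha b hb hab).elim
  · exact hab
  · exact (key b hb a ha hab).elim

/-- **Counting a shell through a determined coordinate.** If for every `z ∈ Z` at most one `w ∈ W` satisfies
`P w z` (e.g. by `card_filter_abs_mul_log_sub_le_one`), then the number of pairs `(w, z) ∈ W × Z` with `P w z` is at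
most the number of `z ∈ Z` admitting such a `w` — Ford–Maynard's "`O_k(x^{ν/100})` choices for the tuple, hence
`S₄ ≪ x^{ν/10} ∑_{m ≤ x^{1-ν/3}} …`": one then bounds the admissible `z` using the size of the determined `w`.
[cite: FordMaynard2024PrimeSieves, Lemma 7.10 (proof, `S₄`)] -/
theorem card_filter_prod_le_of_fiber_le_one {W : Finset ι} {Z : Finset κ} (P : ι → κ → Prop)
    [∀ w z, Decidable (P w z)]
    (hfib : ∀ z ∈ Z, ((W.filter fun w => P w z).card) ≤ 1) :
    ((W ×ˢ Z).filter fun p => P p.1 p.2).card ≤ (Z.filter fun z => ∃ w ∈ W, P w z).card := by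
  classical
  refine Finset.card_le_card_of_injOn (fun p => p.2) ?_ ?_
  · intro p hp
    rw [Finset.mem_coe, Finset.mem_filter, Finset.mem_product] at hp
    rw [Finset.mem_coe, Finset.mem_filter]
    exact ⟨hp.1.2, p.1, hp.1.1, hp.2⟩
  · intro p hp q hq heq
    rw [Finset.mem_coe, Finset.mem_filter, Finset.mem_product] at hp hq
    simp only at heq
    have hcard := hfib p.2 hp.1.2
    have hpm : p.1 ∈ W.filter fun w => P w p.2 := Finset.mem_filter.mpr ⟨hp.1.1, hp.2⟩
    have hqm : q.1 ∈ W.filter fun w => P w p.2 := Finset.mem_filter.mpr ⟨hq.1.1, heq ▸ hq.2⟩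
    have h1 : p.1 = q.1 := Finset.card_le_one.mp hcard _ hpm _ hqm
    exact Prod.ext h1 heq

/-- **The admissible cofactors are small when the determined variable is large**: if `P w z` forces `L₀ < w` and
`w · s(z) ≤ x` (the window), with `s > 0` on `Z` and `L₀ > 0`, then every `z` admitting some `w` has `s(z) < x / L₀`.
(With `L₀ = x^{ν/3}`: the cofactor of the block `∏_{j ∈ ℳ} n_j ≥ x^{ν/3}` is `≤ x^{1-ν/3}`.)
[cite: FordMaynard2024PrimeSieves, Lemma 7.10 (proof, `S₄`: "`m ≤ x^{1-ν/3}`")] -/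
theorem filter_exists_subset_of_window {W : Finset ι} {Z : Finset κ} (P : ι → κ → Prop)
    [∀ w z, Decidable (P w z)] (size : ι → ℝ) (s : κ → ℝ) {x L₀ : ℝ} (hL₀ : 0 < L₀)
    (hs : ∀ z ∈ Z, 0 < s z)
    (hP : ∀ w ∈ W, ∀ z ∈ Z, P w z → L₀ < size w ∧ size w * s z ≤ x) :
    (Z.filter fun z => ∃ w ∈ W, P w z) ⊆ Z.filter fun z => s z < x / L₀ := by
  intro z hz
  rw [Finset.mem_filter] at hz ⊢
  obtain ⟨hzZ, w, hw, hPwz⟩ := hz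
  obtain ⟨hL, hwin⟩ := hP w hw z hzZ hPwz
  refine ⟨hzZ, ?_⟩
  rw [lt_div_iff₀ hL₀]
  calc s z * L₀ < s z * size w := mul_lt_mul_of_pos_left hL (hs z hzZ)
    _ = size w * s z := mul_comm _ _
    _ ≤ x := hwin

/-! ### Mixed strict / non-strict conditions (the faces `S` and `T` of a convex polytope, Definition 5.7) -/

/-- The indicator of one condition with a strictness flag: `[B w < A z]` if `strict`, else `[B w ≤ A z]`.
(Spelled out inline below; this lemma records that either way its norm is `≤ 1`.) [folklore] -/
theorem norm_flagIndicator_le_one (strict : Bool) (a b : ℝ) :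
    ‖(if (if strict then b < a else b ≤ a) then (1 : ℂ) else 0)‖ ≤ 1 := by
  split_ifs <;> simp

/-- A product of flagged threshold indicators has norm at most `1`. [folklore] -/
theorem norm_prod_flagIndicator_le_one (l : List ((κ → ℝ) × (ι → ℝ) × Bool)) (w : ι) (z : κ) :
    ‖(l.map fun p => if (if p.2.2 then p.2.1 w < p.1 z else p.2.1 w ≤ p.1 z) then (1 : ℂ) else 0).prod‖ ≤ 1 := by
  induction l with
  | nil => simp
  | cons p l ih =>
    simp only [List.map_cons, List.prod_cons, norm_mul]
    exact mul_le_one₀ (norm_flagIndicator_le_one _ _ _) (norm_nonneg _) ih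

/-- One flagged condition: `[B w < A z]` or `[B w ≤ A z]` costs at most `(3(1 + log R) + 1) X` plus the shell
(combining `bilin_threshold_shell` and `bilin_threshold_shell_le`). [cite: FordMaynard2024PrimeSieves, Lemma 7.10] -/
theorem bilin_threshold_shell_flag {K : ι → κ → ℂ} {W : Finset ι} {Z : Finset κ} {X : ℝ}
    (h : BilinBoundedBy K W Z X) {A : κ → ℝ} {B : ι → ℝ} (strict : Bool) {R : ℝ} (hR : 1 ≤ R)
    (hsize : ∀ w ∈ W, ∀ z ∈ Z, |A z - B w| ≤ R) :
    BilinBoundedBy (fun w z => (if (if strict then B w < A z else B w ≤ A z) then (1 : ℂ) else 0) * K w z) W Z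
      ((3 * (1 + Real.log R) + 1) * X +
        ∑ w ∈ W, ∑ z ∈ Z, if |A z - B w| < 1 / R then ‖K w z‖ else 0) := by
  have hX0 : 0 ≤ X := h.nonneg
  cases strict with
  | true =>
    refine ((bilin_threshold_shell h hR hsize).mono (by nlinarith)).congr fun w _ z _ => ?_
    simp
  | false =>
    refine ((bilin_threshold_shell_le h hR hsize).mono (le_of_eq (by ring))).congr fun w _ z _ => ?_
    simp

/-- **Ford–Maynard Lemma 7.11 for bilinear forms, mixed strict/non-strict conditions** — the shape of a convex
polytope `{x : c·x < b (c ∈ S), c·x ≤ b (c ∈ T)}` (Definition 5.7) read on `(log pᵢ / log n)`: a list of `r`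
flagged conditions costs `(3(1 + log R) + 1)^r · (X + Σ shells)`. [cite: FordMaynard2024PrimeSieves, Lemma 7.11 and
Definition 5.7] -/
theorem bilin_thresholds_shell_flag {K : ι → κ → ℂ} {W : Finset ι} {Z : Finset κ} {X : ℝ}
    (h : BilinBoundedBy K W Z X) {R : ℝ} (hR : 1 ≤ R) :
    ∀ l : List ((κ → ℝ) × (ι → ℝ) × Bool), (∀ p ∈ l, ∀ w ∈ W, ∀ z ∈ Z, |p.1 z - p.2.1 w| ≤ R) →
      BilinBoundedBy (fun w z =>
        (l.map fun p => if (if p.2.2 then p.2.1 w < p.1 z else p.2.1 w ≤ p.1 z) then (1 : ℂ) else 0).prod *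
          K w z) W Z
        ((3 * (1 + Real.log R) + 1) ^ l.length *
          (X + (l.map fun p => ∑ w ∈ W, ∑ z ∈ Z,
            if |p.1 z - p.2.1 w| < 1 / R then ‖K w z‖ else 0).sum)) := by
  have hX0 : 0 ≤ X := h.nonneg
  have hc1 : 1 ≤ 3 * (1 + Real.log R) + 1 := by
    have := Real.log_nonneg hR; linarith
  intro l
  induction l with
  | nil =>
    intro _
    refine (h.mono (le_of_eq ?_)).congr fun w _ z _ => ?_
    · simp
    · simp
  | cons p l ih =>
    intro hl
    have ih' := ih fun q hq => hl q (List.mem_cons_of_mem p hq)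
    have hp := hl p (List.mem_cons_self)
    have hS0 : ∀ q : (κ → ℝ) × (ι → ℝ) × Bool,
        0 ≤ ∑ w ∈ W, ∑ z ∈ Z, (if |q.1 z - q.2.1 w| < 1 / R then ‖K w z‖ else 0 : ℝ) := fun q =>
      sum_nonneg fun w _ => sum_nonneg fun z _ => by split_ifs <;> simp
    have hL0 : 0 ≤ (l.map fun q => ∑ w ∈ W, ∑ z ∈ Z,
        (if |q.1 z - q.2.1 w| < 1 / R then ‖K w z‖ else 0 : ℝ)).sum :=
      List.sum_nonneg (by
        intro a ha
        obtain ⟨q, _, rfl⟩ := List.mem_map.mp ha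
        exact hS0 q)
    have h1 := bilin_threshold_shell_flag ih' (A := p.1) (B := p.2.1) p.2.2 hR hp
    have hshell : ∑ w ∈ W, ∑ z ∈ Z, (if |p.1 z - p.2.1 w| < 1 / R then
        ‖(l.map fun q => if (if q.2.2 then q.2.1 w < q.1 z else q.2.1 w ≤ q.1 z) then (1 : ℂ) else 0).prod *
          K w z‖ else 0 : ℝ) ≤
        ∑ w ∈ W, ∑ z ∈ Z, (if |p.1 z - p.2.1 w| < 1 / R then ‖K w z‖ else 0 : ℝ) := by
      refine sum_le_sum fun w _ => sum_le_sum fun z _ => ?_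
      split_ifs
      · rw [norm_mul]
        calc _ ≤ 1 * ‖K w z‖ :=
              mul_le_mul_of_nonneg_right (norm_prod_flagIndicator_le_one l w z) (norm_nonneg _)
          _ = ‖K w z‖ := one_mul _
      · exact le_rfl
    refine (h1.mono ?_).congr fun w _ z _ => ?_
    · simp only [List.map_cons, List.sum_cons, List.length_cons, pow_succ]
      set c : ℝ := 3 * (1 + Real.log R) + 1 with hc
      set n : ℕ := l.length
      set Sl : ℝ := (l.map fun q => ∑ w ∈ W, ∑ z ∈ Z,
        (if |q.1 z - q.2.1 w| < 1 / R then ‖K w z‖ else 0 : ℝ)).sum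
      set Sp : ℝ := ∑ w ∈ W, ∑ z ∈ Z, (if |p.1 z - p.2.1 w| < 1 / R then ‖K w z‖ else 0 : ℝ)
      have hcn1 : 1 ≤ c ^ n * c := by
        calc (1 : ℝ) = 1 * 1 := by ring
          _ ≤ c ^ n * c := mul_le_mul (one_le_pow₀ hc1) hc1 zero_le_one (by positivity)
      have hSp0 : 0 ≤ Sp := hS0 p
      calc c * (c ^ n * (X + Sl)) + ∑ w ∈ W, ∑ z ∈ Z, (if |p.1 z - p.2.1 w| < 1 / R then
              ‖(l.map fun q => if (if q.2.2 then q.2.1 w < q.1 z else q.2.1 w ≤ q.1 z) then (1 : ℂ) else 0).prod *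
                K w z‖ else 0 : ℝ)
          ≤ c * (c ^ n * (X + Sl)) + Sp := by linarith [hshell]
        _ ≤ c * (c ^ n * (X + Sl)) + c ^ n * c * Sp := by nlinarith
        _ = c ^ n * c * (X + (Sp + Sl)) := by ring
    · simp only [List.map_cons, List.prod_cons]
      ring

end Summit.Parity.GeneralizedHardyLittlewood.FordMaynardSieveConst01651SieveConst01651
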